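import Literature.MathematicalPhysics.QuantumFieldTheory.Balaban1983to89.B2Eq225PsiOne
import Literature.MathematicalPhysics.QuantumFieldTheory.Balaban1983to89.B2IndStep2115
import Literature.MathematicalPhysics.QuantumFieldTheory.Balaban1983to89.B2LargeField

/-!
# `Balaban1983to89.B2Eq2112Replacement` — [Balaban1982Higgs2] (2.111) → (2.112) p. 580: the printed
`+ O((Lᵏε)^κ)` of (2.112) — the cost of the replacements `C^{(k)}_{Λ₄^{(k)}} ↦ C^{(k)}`, `Λ₆^{(k)} ↦ 1` (and
`ψ ↦ Λ₆^{(k)′}ψ`) in the configuration (2.111) at a vertex `x ∈ Bᵏ(Λ₇^{(k)})` — PROVED from the printed kernel shapes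
(2.58) (Prop. 2.2, for `G_kQ_k^*`), (I.2.34)/(I.2.36) (Prop. I.2.3, for `C^{(k)}`, `δC^{(k)}_{Λ₄}`), the separations of
(2.8) and the threshold (2.16) on `ψ`, *"for every κ"* via `B2StepK.rDecayBeatsPowers`; KNIT with r14's
`B2IndStep2115.eq2112_of_replacement` (its hypothesis `hrepl` is discharged in this currency)

statement-level skeleton of published theorems with citation tags; proofs where landed; nothing here is a claim about the Yang–Mills mass gap

PDF held: `paper:balaban1982-cmp86-higgs23-ii` (T. Bałaban, *(Higgs)₂,₃ quantum fields in a finite volume. II. An upper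
bound*, Commun. Math. Phys. **86** (1982) 555–594, doi 10.1007/bf01214890; journal page = PDF page + 554); p. 580 [PDF 26]
READ AS AN IMAGE on the ×2 render
`run/shared/lean/pub/pub-balaban/b2b-balaban-ref1/pages/1982-cmp86-higgs23-II/1982-cmp86-higgs23-II-p026-x2.png`; pp. 558,
560, 570–571 [PDF 4, 6, 16–17] likewise for (2.7)–(2.8), (2.16), Prop. 2.2 (2.58); part I [Balaban1982Higgs1] Prop. 2.3
p. 611 [PDF 9] for (I.2.34)–(I.2.36).

CITATION HEADER — WHAT IS REPRODUCED.  SKELETON row **B2.Eq2.115** ((2.110)–(2.112), (2.115) pp. 580–582; typed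
p248353 `…B2IndStep2115`, r14 g4: (2.110) `transl2110`, the EXACT part of (2.112) = part I (2.41)/(3.42)
`eq2112_exact`, and `eq2112_of_replacement` with the printed `O((Lᵏε)^κ)` displayed as the HYPOTHESIS `hrepl`), member
**(2.111) → (2.112) p. 580**: this file PROVES that hypothesis currency — the size of the two replacements — from the
printed decay shapes, and knits it (`eq2112_replacement`, `eq2112_replacement_pow`).  Unit `lit-balaban-p15` gen 5
(Phase-2 proof seat p15; HOME `run/shared/lean/pub/lit-balaban/`, seat dir `lit-balaban-p15/`); B2 fold owner r02, second
reader r14; referee ref-4.  Inputs BY NAME: r14's `B2IndStep2115.eq2112_exact`/`eq2112_of_replacement` (p248353) over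
part I's `B1RG242.StepData` (p12) and p14's `B1Eq333Decomposition.eq342_op`; the seat's gen-3 engines
`B2Eq236Replacements.pFn_le_rpow`/`abs_Qs_restrict_le`/`exists_of_Qs_restrict_ne_zero` (p249639) and
`B2Eq238ScalarBoundary.bilin_rowdamped_bound` (p250054), `B2Eq225PsiOne.decay_threshold_pow₁` (p250711); p23's `B2Lemma25Proof.far_sum_bound` (p247392); r14's
`B2StepK.rDecayBeatsPowers` (p240722), `B2LargeField.thrPhi`/`lambdaEps` (p239284); r02's `B2Eq218Translation.restrict`.

WHAT IS PRINTED (p. 580 [PDF 26], verbatim).  *"After the translation (2.110) we make some changes in the interaction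
terms. If x in (aL⁻²C^{(k)}_{Λ₄^{(k)}}(Bᵏ(Λ₂^{(k)}), B^{(k+1),η})Q*(B^{(k+1),η})ψ)(x) is a vertex variable, then x ∈ Λ₇^{(k)},
and we replace this configuration by (aL⁻²C^{(k)}(Bᵏ(Λ₂^{(k)}), B^{(k+1),η})Q*(B^{(k+1),η})Λ₆^{(k)′}ψ)(x). If the
configuration appears in the expression
(a_kG_k(Bᵏ(Λ₂^{(k)}), B^{(k+1),η})Q_k^*(B^{(k+1),η})Λ₆^{(k)}aL⁻²·C^{(k)}_{Λ₄^{(k)}}(Bᵏ(Λ₂^{(k)}), B^{(k+1),η})Q*(B^{(k+1),η})ψ)(x),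
(2.111)  then x ∈ Bᵏ(Λ₇^{(k)}), and we replace C^{(k)}_{Λ₄^{(k)}} by C^{(k)}, Λ₆^{(k)} by 1, and using the recursive equation
(I.2.41) we get  (2.111) = (a_{k+1}L⁻²G^η_{k+1}(Bᵏ(Λ₂^{(k)}), B^{(k+1),η})Q*_{k+1}(B^{(k+1),η})Λ₆^{(k)′}ψ)(x) + O((Lᵏε)^κ).
(2.112)"*  The inputs, verbatim.  Prop. 2.2 (2.58) pp. 570–571: *"|(D^η_AG_k(Ω, A)Q_k^*(A))(b, y)| ≤ c₀exp(−δ₀dist(b, y)),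
(2.58) for b ⊂ Ω, dist(b, Ωᶜ) ≥ R₀, y ∈ Ω^{(k)}. The identical inequality holds for G_k(Ω, A)Q_k^*(A)"*; part I Prop. 2.3
p. 611: *"|C^{(k)}_Λ(Ω, A; x, x′)| ≦ c₀exp(−δ₀|x − x′|), x, x′ ∈ Λ. (2.34) … δC^{(k)}_Λ(Ω, A) = C^{(k)}_Λ(Ω, A) − C^{(k)}(Ω, A),
(2.35) … |δC^{(k)}_Λ(Ω, A; x, x′)| ≦ c₀exp(−δ₀(|x − x′| + dist(x, Λᶜ) + dist(x′, Λᶜ))), x, x′ ∈ Λ. (2.36)"*; the geometry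
(2.8) p. 558 (*"Λ_{i+1}ᶜ is the sum of all large blocks of T₁ with distances from the set Λ_iᶜ less or equal r(ε)"*,
r(ε) = R(1 + log ε⁻¹)ʳ, r > 1, at the scale Lᵏε, p. 566); the threshold (2.16) p. 560 *"|ψ(y)| ≦ (2/λ(ε)^{1/4})p(ε) for
y ∈ Λ′₋₁"* with *"The same estimates as (2.16), (2.17) will hold for the fields in each step with ε replaced by the
corresponding Lᵏε"*, λ(ε) = λε^{4−d} (2.5), p(ε) = b₀(1 + log ε⁻¹)ᵖ (2.3).

THE ARGUMENT (the print gives none beyond naming the replacements; the evident one, three kernel sums).  Write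
`𝒢 = G_kQ_k^*` (fine × unit kernel), `c = aL⁻²`, `w = Λ₄′ψ` (the only part of `ψ` the Dirichlet covariance sees),
`v = Λ₆′ψ`.  At `x ∈ Bᵏ(Λ₇)`:  `Σ_y𝒢(x,y)Λ₆(y)(cC_{Λ₄}Q*ψ)(y) − Σ_y𝒢(x,y)(cCQ*v)(y) = c·[E₁ + E₂ − E₃]` with
`E₁ = Σ_{y∈Λ₆}Σ_{y′}𝒢(x,y)(C_{Λ₄} − C)(y,y′)(Q*w)(y′)` — ROW-DAMPED: `y ∈ Λ₆` lies `≥ R` inside `Λ₄` ((2.8), two layers) and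
`(C_{Λ₄} − C)(y,·)` is `δC_{Λ₄}(y,·)` on `Λ₄` ((I.2.36)) and `−C(y,·)` off `Λ₄` ((I.2.34) at distance `≥ dist(y,Λ₄ᶜ)`);
`E₂ = Σ_{y∈Λ₆}Σ_{y′}𝒢(x,y)C(y,y′)(Q*(w − v))(y′)` — COMPOSITE-FAR: `Q*(Λ₄′∖Λ₆′)ψ` lives off `Λ₆`, at distance `≥ R` from
`x` ((2.8): `x ∈ Bᵏ(Λ₇)`), so one of the two kernels runs `≥ R/2`;  `E₃ = Σ_{y∉Λ₆}𝒢(x,y)(CQ*v)(y)` — FAR in `𝒢`.  Each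
is `≤ c₀c₁qs₁S₁S₂·G·e^{−½δ₀R}` (`G` the threshold for `|ψ|` on `Λ₄′`), and `G·e^{−½δ₀r(Lᵏε)} ≤ C_κ(Lᵏε)^κ` for every κ.

DICTIONARY (plain real coordinates, as in the seat's (2.36)–(2.40) files).  `ι` ↤ components of the η-lattice fields
(`x ∈ Bᵏ(Λ₇^{(k)})` a fixed index), `κ` ↤ components of the unit-lattice (`T₁^{(k)}`) fields, `ν` ↤ components of the block
(`L`-lattice, `T^{(k+1)′}`) fields; `GQ : Matrix ι κ ℝ` ↤ `G_k(Bᵏ(Λ₂^{(k)}), B^{(k+1),η})Q_k^*(B^{(k+1),η})` (in the knit: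
`S.Gk * S.Qks` of `B1RG242.StepData`), `CΛ : Matrix κ κ ℝ` ↤ `C^{(k)}_{Λ₄^{(k)}}(…)` extended by zero (`hCs`: column support
in `Λ₄`), `C : Matrix κ κ ℝ` ↤ `C^{(k)}(…)` (knit: `S.Ck`), `Qs : Matrix κ ν ℝ` ↤ `Q*(B^{(k+1),η})` (knit: `S.Qs`) with the
row-sum bound `qs₁` (`= 1` for the 0/1 block-adjoint kernel) and the block structure `hQ4`/`hQ6` (`Q*(y,z) ≠ 0 ⇒ (y ∈ Λ₄ ⇔
z ∈ Λ₄′)`, same for `Λ₆`, `Λ₆′`: *"unions of big blocks"*); `α` ↤ `a_k`, `β` ↤ `aL⁻²`; `Λ₆ ⊆ Λ₄ : Finset κ` ↤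
`Λ₆^{(k)} ⊆ Λ₄^{(k)}`, `Λ₆' ⊆ Λ₄' : Finset ν` ↤ `Λ₆^{(k)′} ⊆ Λ₄^{(k)′}`; `d₁ x y` ↤ `dist(x, y)` of (2.58), `d₂ y y′` ↤ `|y − y′|`,
`u y` ↤ `dist(y, Λ₄ᶜ)` of (I.2.36) (`hu_le`: it IS a distance to `Λ₄ᶜ`; `htri`: triangle inequality); separations ↤ (2.8)
at scale `Lᵏε`: `hfar6` (`y ∉ Λ₆ ⇒ dist(x,y) ≥ R` for our `x ∈ Bᵏ(Λ₇)`), `hdeep` (`y ∈ Λ₆ ⇒ dist(y,Λ₄ᶜ) ≥ R`); `G` ↤ the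
threshold for `|ψ|` on `Λ₄′` ((2.16): `2p(ℓ)/λ(ℓ)^{1/4}`, `ℓ = Lᵏε`); `S₁`, `S₂` ↤ bounds for `Σ_ye^{−¼δ₀dist(x,y)}`,
`Σ_{y′}e^{−¼δ₀|y−y′|}` (on `ℤ^d`: `B2Lemma25Proof.sum_exp_neg_l1dist_le`); `R` ↤ the separation (`≥ r(Lᵏε)`).

WHAT IS KERNEL-CHECKED (zero `sorry`, standard axioms, NO definitions).
 §0 `two_thrPhi_pFn_eq` ((2.16)'s `2p(ℓ)/λ(ℓ)^{1/4} = 2λ^{−1/4}·p(ℓ)·ℓ^{−(4−d)/4}`), `decay_thr216_pow`;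
 §1 engines: `sum_exp_le_of_rate`, `sum_abs_kernel_le`, `comp_far_bound` (two kernels, far in the composite distance);
 §2 **(2.111) → (2.112)**: `mulVec_CΛ_eq_restrict` (the Dirichlet covariance sees `Λ₄′ψ` only), `diff_decomp` (the exact
    three-term decomposition), `rowdamped_of_printed` ((I.2.34) + (I.2.36) ⇒ the row-damped shape of `C_{Λ₄} − C` on the
    rows of `Λ₄`), `E1_bound`, `E2_bound`, `E3_bound`, **`eq2112_error_bound`** (`|(2.111)(x) − a_kaL⁻²(𝒢CQ*Λ₆′ψ)(x)| ≤
    |a_kaL⁻²|·3c₀c₁qs₁S₁S₂·G·e^{−½δ₀R}`), **`eq2112_error_pow`** (`≤ … ·C_κℓ^κ` for `R ≥ r(ℓ)`), plus the vertex-variable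
    replacement of the sentence before (2.111): **`vertex_replacement_bound`**;
 §3 KNIT over `B1RG242.StepData`: `lhs2111_eq`, `rhs2112_eq`, **`eq2112_replacement`** (= r14's `eq2112_of_replacement`
    with `hrepl` DISCHARGED: `|(2.111)(x) − (a_{k+1}L⁻²G_{k+1}Q*_{k+1}Λ₆′ψ)(x)| ≤ |a_kaL⁻²|·3c₀c₁qs₁S₁S₂·G·e^{−½δ₀R}`),
    **`eq2112_replacement_pow`**.
HONEST SCOPE.  As in the sibling (2.36)–(2.40) files: the operators are data carrying the printed structural facts as
hypotheses IN THE PRINTED FORM (decay shapes (2.58)/(I.2.34)/(I.2.36), Dirichlet support, block structure of `Q*`, the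
(2.8) separations, the (2.16) threshold); the analytic theorems Prop. 2.2 / Prop. I.2.3 themselves are NOT proved here
(rows B2.Prop2.2, B1.Prop2.3), nor is the integral (2.115).
-/

namespace Literature.MathematicalPhysics.QuantumFieldTheory.Balaban1983to89.B2Eq2112Replacement

open Real Matrix
open B2Eq218Translation (restrict)
open B2Eq236Replacements (pFn_le_rpow pFn_nonneg abs_Qs_restrict_le exists_of_Qs_restrict_ne_zero)
open B2Lemma25Proof (far_sum_bound)
open B2Eq238ScalarBoundary (bilin_rowdamped_bound)
open B2Eq225PsiOne (decay_threshold_pow₁)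

/-! ## §0 The printed threshold (2.16) against the decay: *"O((Lᵏε)^κ)"* for every κ -/

/-- The (2.16) threshold in the power form: `2p(ℓ)/λ(ℓ)^{1/4} = (2λ^{−1/4})·p(ℓ)·ℓ^{−(4−d)/4}` with `λ(ℓ) = λℓ^{4−d}`
(`B2LargeField.lambdaEps`), for `λ > 0`, `ℓ > 0`. [cite: Balaban1982Higgs2, (2.16) p.560] -/
theorem two_thrPhi_pFn_eq {lam ℓ b₀ p : ℝ} (hlam : 0 < lam) (hℓ : 0 < ℓ) (d : ℕ) :
    2 * B2LargeField.thrPhi lam ℓ d (B2.pFn b₀ p ℓ)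
      = (2 * lam ^ (-(1 / 4 : ℝ))) * B2.pFn b₀ p ℓ * ℓ ^ (-(((4 : ℝ) - d) / 4)) := by
  unfold B2LargeField.thrPhi B2LargeField.lambdaEps
  have hz : ℓ ^ ((4 : ℤ) - d) = ℓ ^ ((4 : ℝ) - d) := by
    rw [← Real.rpow_intCast]
    push_cast
    ring_nf
  rw [hz, Real.mul_rpow hlam.le (Real.rpow_nonneg hℓ.le _), ← Real.rpow_mul hℓ.le]
  have h1 : lam ^ (-(1 / 4 : ℝ)) = (lam ^ (1 / 4 : ℝ))⁻¹ := Real.rpow_neg hlam.le _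
  have h2 : ℓ ^ (-(((4 : ℝ) - d) / 4)) = (ℓ ^ (((4 : ℝ) - d) * (1 / 4)))⁻¹ := by
    rw [← Real.rpow_neg hℓ.le]
    congr 1
    ring
  rw [h1, h2]
  have h3 : 0 < lam ^ (1 / 4 : ℝ) := Real.rpow_pos_of_pos hlam _
  have h4 : 0 < ℓ ^ (((4 : ℝ) - d) * (1 / 4)) := Real.rpow_pos_of_pos hℓ _
  field_simp

/-- **"O((Lᵏε)^κ)" under the PRINTED threshold (2.16)**: for `a > 0`, the ranges of (2.7), `b₀ ≥ 0`, `p ≥ 0`, `λ > 0`,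
every `d` and every real `κ` there is `C ≥ 0` with `e^{−a·r(ℓ)}·(2p(ℓ)/λ(ℓ)^{1/4}) ≤ C·ℓ^κ` for all `ℓ ∈ (0,1]`.
[cite: Balaban1982Higgs2, (2.112) p.580] -/
theorem decay_thr216_pow {a Rr r b₀ p lam : ℝ} (ha : 0 < a) (hR : 0 < Rr) (hr : 1 < r) (hb : 0 ≤ b₀) (hp : 0 ≤ p)
    (hlam : 0 < lam) (d : ℕ) (κ : ℝ) :
    ∃ C : ℝ, 0 ≤ C ∧ ∀ ℓ : ℝ, 0 < ℓ → ℓ ≤ 1 →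
      Real.exp (-(a * B2.rFn Rr r ℓ)) * (2 * B2LargeField.thrPhi lam ℓ d (B2.pFn b₀ p ℓ)) ≤ C * ℓ ^ κ := by
  obtain ⟨C, hC0, hC⟩ := decay_threshold_pow₁ (m := ((4 : ℝ) - d) / 4) ha hR hr hb hp
    (show (0 : ℝ) ≤ 2 * lam ^ (-(1 / 4 : ℝ)) by positivity) κ
  refine ⟨C, hC0, fun ℓ hℓ hℓ1 => ?_⟩
  rw [two_thrPhi_pFn_eq hlam hℓ d]
  exact hC ℓ hℓ hℓ1

/-! ## §1 Engines -/

section Engine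

variable {Y : Type*}

/-- Summability at a slower rate dominates: if `δ/4 ≤ θ`, `t ≥ 0` on `S` and `Σ_{S}e^{−¼δt} ≤ T` then `Σ_{S}e^{−θt} ≤ T`.
[folklore] [cite: Balaban1982Higgs2, (2.112) p.580] -/
theorem sum_exp_le_of_rate {S : Finset Y} {t : Y → ℝ} {θ δ T : ℝ} (hθ : δ / 4 ≤ θ) (ht : ∀ y ∈ S, 0 ≤ t y)
    (hT : ∑ y ∈ S, Real.exp (-(δ / 4 * t y)) ≤ T) : ∑ y ∈ S, Real.exp (-(θ * t y)) ≤ T := by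
  refine le_trans (Finset.sum_le_sum fun y hy => ?_) hT
  rw [Real.exp_le_exp]
  have := ht y hy
  nlinarith

/-- The row sum of a decaying kernel: `|K(y)| ≤ c₁e^{−δa(y)}`, `a ≥ 0`, `δ ≥ 0`, `Σ_{S}e^{−¼δa} ≤ T` give
`Σ_{S}|K| ≤ c₁T`. [folklore] [cite: Balaban1982Higgs2, (2.112) p.580] -/
theorem sum_abs_kernel_le {S : Finset Y} {K a : Y → ℝ} {c₁ δ T : ℝ} (hc₁ : 0 ≤ c₁) (hδ : 0 ≤ δ)
    (hK : ∀ y ∈ S, |K y| ≤ c₁ * Real.exp (-(δ * a y))) (ha : ∀ y ∈ S, 0 ≤ a y)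
    (hT : ∑ y ∈ S, Real.exp (-(δ / 4 * a y)) ≤ T) : ∑ y ∈ S, |K y| ≤ c₁ * T := by
  have h1 : ∑ y ∈ S, |K y| ≤ ∑ y ∈ S, c₁ * Real.exp (-(δ * a y)) := Finset.sum_le_sum hK
  have h2 : ∑ y ∈ S, c₁ * Real.exp (-(δ * a y)) = c₁ * ∑ y ∈ S, Real.exp (-(δ * a y)) := by
    rw [Finset.mul_sum]
  have h3 : ∑ y ∈ S, Real.exp (-(δ * a y)) ≤ T := sum_exp_le_of_rate (by linarith) ha hT
  calc ∑ y ∈ S, |K y| ≤ c₁ * ∑ y ∈ S, Real.exp (-(δ * a y)) := h1.trans h2.le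
    _ ≤ c₁ * T := mul_le_mul_of_nonneg_left h3 hc₁

/-- **COMPOSITE-FAR engine** (two kernels): if `|K₁(y)| ≤ c₁e^{−δa(y)}`, `|K₂(y,y′)| ≤ c₀e^{−δb(y,y′)}`, the support of
`g` is `≥ R` away in the composite distance (`g(y′) ≠ 0 ⇒ R ≤ a(y) + b(y,y′)`), `|g| ≤ G`, `Σ_ye^{−½δa} ≤ T₁`,
`Σ_{y′}e^{−½δb(y,·)} ≤ T₂` (`T₂ ≥ 0`), then `|Σ_yΣ_{y′}K₁(y)K₂(y,y′)g(y′)| ≤ c₁c₀e^{−½δR}·G·T₁T₂` — one of the two kernels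
runs at least half the way. [cite: Balaban1982Higgs2, (2.112) p.580] -/
theorem comp_far_bound {S₁ S₂ : Finset Y} {K₁ : Y → ℝ} {K₂ : Y → Y → ℝ} {g : Y → ℝ} {a : Y → ℝ} {b : Y → Y → ℝ}
    {c₁ c₀ δ R G T₁ T₂ : ℝ} (hc₁ : 0 ≤ c₁) (hc₀ : 0 ≤ c₀) (hδ : 0 ≤ δ) (hG : 0 ≤ G) (hT₂ : 0 ≤ T₂)
    (hK₁ : ∀ y ∈ S₁, |K₁ y| ≤ c₁ * Real.exp (-(δ * a y)))
    (hK₂ : ∀ y ∈ S₁, ∀ y' ∈ S₂, |K₂ y y'| ≤ c₀ * Real.exp (-(δ * b y y')))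
    (hfar : ∀ y ∈ S₁, ∀ y' ∈ S₂, g y' ≠ 0 → R ≤ a y + b y y')
    (hg : ∀ y' ∈ S₂, |g y'| ≤ G)
    (hS₁ : ∑ y ∈ S₁, Real.exp (-(δ / 2 * a y)) ≤ T₁)
    (hS₂ : ∀ y ∈ S₁, ∑ y' ∈ S₂, Real.exp (-(δ / 2 * b y y')) ≤ T₂) :
    |∑ y ∈ S₁, ∑ y' ∈ S₂, K₁ y * K₂ y y' * g y'| ≤ c₁ * c₀ * Real.exp (-(δ / 2 * R)) * G * T₁ * T₂ := by
  have hinner : ∀ y ∈ S₁, |∑ y' ∈ S₂, K₂ y y' * g y'| ≤ c₀ * Real.exp (-(δ / 2 * (R - a y))) * G * T₂ := by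
    intro y hy
    exact far_sum_bound hc₀ hδ hG (hK₂ y hy)
      (fun y' hy' hg' => by have := hfar y hy y' hy' hg'; linarith) hg (hS₂ y hy)
  have hterm : ∀ y ∈ S₁, |K₁ y| * |∑ y' ∈ S₂, K₂ y y' * g y'| ≤
      (c₁ * c₀ * Real.exp (-(δ / 2 * R)) * G * T₂) * Real.exp (-(δ / 2 * a y)) := by
    intro y hy
    calc |K₁ y| * |∑ y' ∈ S₂, K₂ y y' * g y'|
        ≤ (c₁ * Real.exp (-(δ * a y))) * (c₀ * Real.exp (-(δ / 2 * (R - a y))) * G * T₂) :=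
          mul_le_mul (hK₁ y hy) (hinner y hy) (abs_nonneg _) (by positivity)
      _ = (c₁ * c₀ * G * T₂) * (Real.exp (-(δ * a y)) * Real.exp (-(δ / 2 * (R - a y)))) := by ring
      _ = (c₁ * c₀ * G * T₂) * (Real.exp (-(δ / 2 * R)) * Real.exp (-(δ / 2 * a y))) := by
          congr 1
          rw [← Real.exp_add, ← Real.exp_add]
          congr 1
          ring
      _ = (c₁ * c₀ * Real.exp (-(δ / 2 * R)) * G * T₂) * Real.exp (-(δ / 2 * a y)) := by ring
  calc |∑ y ∈ S₁, ∑ y' ∈ S₂, K₁ y * K₂ y y' * g y'|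
      ≤ ∑ y ∈ S₁, |∑ y' ∈ S₂, K₁ y * K₂ y y' * g y'| := Finset.abs_sum_le_sum_abs _ _
    _ = ∑ y ∈ S₁, |K₁ y| * |∑ y' ∈ S₂, K₂ y y' * g y'| := by
        refine Finset.sum_congr rfl fun y _ => ?_
        rw [← abs_mul, Finset.mul_sum]
        congr 1
        exact Finset.sum_congr rfl fun y' _ => by ring
    _ ≤ ∑ y ∈ S₁, (c₁ * c₀ * Real.exp (-(δ / 2 * R)) * G * T₂) * Real.exp (-(δ / 2 * a y)) :=
        Finset.sum_le_sum hterm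
    _ = (c₁ * c₀ * Real.exp (-(δ / 2 * R)) * G * T₂) * ∑ y ∈ S₁, Real.exp (-(δ / 2 * a y)) := by
        rw [Finset.mul_sum]
    _ ≤ (c₁ * c₀ * Real.exp (-(δ / 2 * R)) * G * T₂) * T₁ :=
        mul_le_mul_of_nonneg_left hS₁ (by positivity)
    _ = c₁ * c₀ * Real.exp (-(δ / 2 * R)) * G * T₁ * T₂ := by ring

end Engine


/-! ## §2 **(2.111) → (2.112)** p. 580: the replacements `C^{(k)}_{Λ₄} ↦ C^{(k)}`, `Λ₆ ↦ 1` cost `O((Lᵏε)^κ)` -/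

section Main

variable {ι κ ν : Type*} [Fintype κ] [Fintype ν] [DecidableEq κ] [DecidableEq ν]

omit [Fintype κ] [DecidableEq κ] in
/-- For `y′ ∈ Λ₄` the block adjoint sees `ψ` on `Λ₄′` only: `(Q*ψ)(y′) = (Q*Λ₄′ψ)(y′)` (*"unions of big blocks"*, the
block structure `hQ4`). [cite: Balaban1982Higgs2, (2.111) p.580] -/
theorem Qs_mulVec_eq_restrict {Qs : Matrix κ ν ℝ} {Λ₄ : Finset κ} {Λ₄' : Finset ν}
    (hQ4 : ∀ y z, Qs y z ≠ 0 → (y ∈ Λ₄ ↔ z ∈ Λ₄')) (ψ : ν → ℝ) {y : κ} (hy : y ∈ Λ₄) :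
    (Qs *ᵥ ψ) y = (Qs *ᵥ restrict Λ₄' ψ) y := by
  change ∑ z, Qs y z * ψ z = ∑ z, Qs y z * restrict Λ₄' ψ z
  refine Finset.sum_congr rfl fun z _ => ?_
  by_cases hQ : Qs y z = 0
  · rw [hQ, zero_mul, zero_mul]
  · have hz : z ∈ Λ₄' := (hQ4 y z hQ).1 hy
    rw [show restrict Λ₄' ψ z = ψ z from if_pos hz]

omit [DecidableEq κ] in
/-- The Dirichlet covariance sees `Λ₄′ψ` only: `(C^{(k)}_{Λ₄}Q*ψ)(y) = (C^{(k)}_{Λ₄}Q*Λ₄′ψ)(y)` (column support of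
`C^{(k)}_{Λ₄}` in `Λ₄`, `hCs`, and the block structure `hQ4`). [cite: Balaban1982Higgs2, (2.111) p.580] -/
theorem mulVec_CΛ_eq_restrict {CΛ : Matrix κ κ ℝ} {Qs : Matrix κ ν ℝ} {Λ₄ : Finset κ} {Λ₄' : Finset ν}
    (hCs : ∀ y y', CΛ y y' ≠ 0 → y' ∈ Λ₄) (hQ4 : ∀ y z, Qs y z ≠ 0 → (y ∈ Λ₄ ↔ z ∈ Λ₄')) (ψ : ν → ℝ) (y : κ) :
    (CΛ *ᵥ (Qs *ᵥ ψ)) y = (CΛ *ᵥ (Qs *ᵥ restrict Λ₄' ψ)) y := by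
  change ∑ y', CΛ y y' * (Qs *ᵥ ψ) y' = ∑ y', CΛ y y' * (Qs *ᵥ restrict Λ₄' ψ) y'
  refine Finset.sum_congr rfl fun y' _ => ?_
  by_cases hC : CΛ y y' = 0
  · rw [hC, zero_mul, zero_mul]
  · rw [Qs_mulVec_eq_restrict hQ4 ψ (hCs y y' hC)]

omit [Fintype κ] [Fintype ν] [DecidableEq κ] in
/-- `Λ₄′ψ − Λ₆′ψ = (Λ₄′∖Λ₆′)ψ` for `Λ₆′ ⊆ Λ₄′`. [folklore] [cite: Balaban1982Higgs2, (2.111) p.580] -/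
theorem restrict_sub_restrict {Λ₄' Λ₆' : Finset ν} (h : Λ₆' ⊆ Λ₄') (ψ : ν → ℝ) :
    restrict Λ₄' ψ - restrict Λ₆' ψ = restrict (Λ₄' \ Λ₆') ψ := by
  funext z
  simp only [restrict, Pi.sub_apply, Finset.mem_sdiff]
  by_cases h4 : z ∈ Λ₄'
  · by_cases h6 : z ∈ Λ₆' <;> simp [h4, h6]
  · have h6 : z ∉ Λ₆' := fun h6 => h4 (h h6)
    simp [h4, h6]

/-- **The exact decomposition behind (2.112)**: with `𝒢 = G_kQ_k^*`, `w = Λ₄′ψ`, `v = Λ₆′ψ`, at the vertex `x`,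
`Σ_{y∈Λ₆}𝒢(x,y)(C_{Λ₄}Q*ψ)(y) − Σ_y𝒢(x,y)(CQ*v)(y) = E₁ + E₂ − E₃` with
`E₁ = Σ_{y∈Λ₆}Σ_{y′}𝒢(x,y)(C_{Λ₄} − C)(y,y′)(Q*w)(y′)`, `E₂ = Σ_{y∈Λ₆}Σ_{y′}𝒢(x,y)C(y,y′)(Q*(Λ₄′∖Λ₆′)ψ)(y′)`,
`E₃ = Σ_{y∉Λ₆}𝒢(x,y)(CQ*v)(y)`. KERNEL (exact algebra). [cite: Balaban1982Higgs2, (2.112) p.580] -/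
theorem diff_decomp (GQ : Matrix ι κ ℝ) (CΛ C : Matrix κ κ ℝ) (Qs : Matrix κ ν ℝ) {Λ₄ Λ₆ : Finset κ}
    {Λ₄' Λ₆' : Finset ν} (hCs : ∀ y y', CΛ y y' ≠ 0 → y' ∈ Λ₄)
    (hQ4 : ∀ y z, Qs y z ≠ 0 → (y ∈ Λ₄ ↔ z ∈ Λ₄')) (h64' : Λ₆' ⊆ Λ₄') (ψ : ν → ℝ) (x : ι) :
    ∑ y ∈ Λ₆, GQ x y * (CΛ *ᵥ (Qs *ᵥ ψ)) y - ∑ y, GQ x y * (C *ᵥ (Qs *ᵥ restrict Λ₆' ψ)) y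
      = ∑ y ∈ Λ₆, ∑ y', GQ x y * (CΛ - C) y y' * (Qs *ᵥ restrict Λ₄' ψ) y'
        + ∑ y ∈ Λ₆, ∑ y', GQ x y * C y y' * (Qs *ᵥ restrict (Λ₄' \ Λ₆') ψ) y'
        - ∑ y ∈ Λ₆ᶜ, GQ x y * (C *ᵥ (Qs *ᵥ restrict Λ₆' ψ)) y := by
  have hsplit : ∑ y, GQ x y * (C *ᵥ (Qs *ᵥ restrict Λ₆' ψ)) y
      = ∑ y ∈ Λ₆, GQ x y * (C *ᵥ (Qs *ᵥ restrict Λ₆' ψ)) y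
        + ∑ y ∈ Λ₆ᶜ, GQ x y * (C *ᵥ (Qs *ᵥ restrict Λ₆' ψ)) y :=
    (Finset.sum_add_sum_compl Λ₆ _).symm
  have hrow : ∀ y ∈ Λ₆, GQ x y * (CΛ *ᵥ (Qs *ᵥ ψ)) y - GQ x y * (C *ᵥ (Qs *ᵥ restrict Λ₆' ψ)) y
      = ∑ y', GQ x y * (CΛ - C) y y' * (Qs *ᵥ restrict Λ₄' ψ) y'
        + ∑ y', GQ x y * C y y' * (Qs *ᵥ restrict (Λ₄' \ Λ₆') ψ) y' := by
    intro y _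
    rw [mulVec_CΛ_eq_restrict hCs hQ4 ψ y, ← restrict_sub_restrict h64' ψ, Matrix.mulVec_sub]
    have e1 : (CΛ *ᵥ (Qs *ᵥ restrict Λ₄' ψ)) y = ∑ y', CΛ y y' * (Qs *ᵥ restrict Λ₄' ψ) y' := rfl
    have e2 : (C *ᵥ (Qs *ᵥ restrict Λ₆' ψ)) y = ∑ y', C y y' * (Qs *ᵥ restrict Λ₆' ψ) y' := rfl
    rw [e1, e2, Finset.mul_sum, Finset.mul_sum, ← Finset.sum_sub_distrib, ← Finset.sum_add_distrib]
    refine Finset.sum_congr rfl fun y' _ => ?_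
    rw [Matrix.sub_apply, Pi.sub_apply]
    ring
  have H : ∑ y ∈ Λ₆, GQ x y * (CΛ *ᵥ (Qs *ᵥ ψ)) y - ∑ y ∈ Λ₆, GQ x y * (C *ᵥ (Qs *ᵥ restrict Λ₆' ψ)) y
      = ∑ y ∈ Λ₆, ∑ y', GQ x y * (CΛ - C) y y' * (Qs *ᵥ restrict Λ₄' ψ) y'
        + ∑ y ∈ Λ₆, ∑ y', GQ x y * C y y' * (Qs *ᵥ restrict (Λ₄' \ Λ₆') ψ) y' := by
    rw [← Finset.sum_sub_distrib, ← Finset.sum_add_distrib]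
    exact Finset.sum_congr rfl hrow
  rw [hsplit]
  linear_combination H

omit [Fintype κ] [Fintype ν] [DecidableEq ν] in
/-- **(I.2.34) + (I.2.36) ⇒ the row-damped shape of `C_{Λ₄} − C` on the rows of `Λ₄`**: for `y ∈ Λ₄` and every `y′`,
`|(C_{Λ₄} − C)(y,y′)| ≤ c₀e^{−½δ₀(|y − y′| + dist(y,Λ₄ᶜ))}` — inside `Λ₄` by (I.2.36) (`dist(y′,Λ₄ᶜ) ≥ 0` dropped), outside
`Λ₄` `C_{Λ₄}(y,y′) = 0` and `|y − y′| ≥ dist(y,Λ₄ᶜ)`. [cite: Balaban1982Higgs1, (2.36) p.611] -/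
theorem rowdamped_of_printed {CΛ C : Matrix κ κ ℝ} {Λ₄ : Finset κ} {d₂ : κ → κ → ℝ} {u : κ → ℝ} {c₀ δ : ℝ}
    (hc₀ : 0 ≤ c₀) (hδ : 0 ≤ δ) (hd₂ : ∀ y y', 0 ≤ d₂ y y') (hu0 : ∀ y, 0 ≤ u y)
    (hCs : ∀ y y', CΛ y y' ≠ 0 → y' ∈ Λ₄)
    (hC : ∀ y y', |C y y'| ≤ c₀ * Real.exp (-(δ * d₂ y y')))
    (hδC : ∀ y ∈ Λ₄, ∀ y' ∈ Λ₄, |CΛ y y' - C y y'| ≤ c₀ * Real.exp (-(δ * (d₂ y y' + u y + u y'))))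
    (hu_le : ∀ y y', y' ∉ Λ₄ → u y ≤ d₂ y y') {y : κ} (hy : y ∈ Λ₄) (y' : κ) :
    |(CΛ - C) y y'| ≤ c₀ * Real.exp (-(δ / 2 * (d₂ y y' + u y))) := by
  rw [Matrix.sub_apply]
  by_cases hy' : y' ∈ Λ₄
  · refine (hδC y hy y' hy').trans (mul_le_mul_of_nonneg_left ?_ hc₀)
    rw [Real.exp_le_exp]
    have := hd₂ y y'
    have := hu0 y
    have := hu0 y'
    nlinarith
  · have h0 : CΛ y y' = 0 := by
      by_contra h
      exact hy' (hCs y y' h)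
    rw [h0, zero_sub, abs_neg]
    refine (hC y y').trans (mul_le_mul_of_nonneg_left ?_ hc₀)
    rw [Real.exp_le_exp]
    have := hu_le y y' hy'
    have := hd₂ y y'
    nlinarith

/-- **E₁, row-damped**: `|Σ_{y∈Λ₆}Σ_{y′}𝒢(x,y)(C_{Λ₄} − C)(y,y′)(Q*Λ₄′ψ)(y′)| ≤ c₁S₁·c₀e^{−½δ₀R}·qs₁G·S₂` — the rows
`y ∈ Λ₆` lie `≥ R` inside `Λ₄` (`hdeep`, (2.8)). [cite: Balaban1982Higgs2, (2.112) p.580] -/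
theorem E1_bound {GQ : Matrix ι κ ℝ} {CΛ C : Matrix κ κ ℝ} {Qs : Matrix κ ν ℝ} {Λ₄ Λ₆ : Finset κ} {Λ₄' : Finset ν}
    {ψ : ν → ℝ} {x : ι} {d₁ : ι → κ → ℝ} {d₂ : κ → κ → ℝ} {u : κ → ℝ} {c₀ c₁ δ R G qs₁ S₁ S₂ : ℝ}
    (hc₀ : 0 ≤ c₀) (hc₁ : 0 ≤ c₁) (hδ : 0 ≤ δ) (hG : 0 ≤ G) (hqs : 0 ≤ qs₁) (hS₂0 : 0 ≤ S₂)
    (h64 : Λ₆ ⊆ Λ₄) (hd₁ : ∀ y, 0 ≤ d₁ x y) (hd₂ : ∀ y y', 0 ≤ d₂ y y') (hu0 : ∀ y, 0 ≤ u y)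
    (hGQ : ∀ y, |GQ x y| ≤ c₁ * Real.exp (-(δ * d₁ x y)))
    (hCs : ∀ y y', CΛ y y' ≠ 0 → y' ∈ Λ₄)
    (hC : ∀ y y', |C y y'| ≤ c₀ * Real.exp (-(δ * d₂ y y')))
    (hδC : ∀ y ∈ Λ₄, ∀ y' ∈ Λ₄, |CΛ y y' - C y y'| ≤ c₀ * Real.exp (-(δ * (d₂ y y' + u y + u y'))))
    (hu_le : ∀ y y', y' ∉ Λ₄ → u y ≤ d₂ y y') (hdeep : ∀ y ∈ Λ₆, R ≤ u y)
    (hψ : ∀ z ∈ Λ₄', |ψ z| ≤ G) (hQs1 : ∀ y, ∑ z, |Qs y z| ≤ qs₁)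
    (hS₁ : ∑ y, Real.exp (-(δ / 4 * d₁ x y)) ≤ S₁) (hS₂ : ∀ y, ∑ y', Real.exp (-(δ / 4 * d₂ y y')) ≤ S₂) :
    |∑ y ∈ Λ₆, ∑ y', GQ x y * (CΛ - C) y y' * (Qs *ᵥ restrict Λ₄' ψ) y'|
      ≤ (c₁ * S₁) * (c₀ * Real.exp (-(δ / 2 * R)) * (qs₁ * G) * S₂) := by
  have hF : ∑ y ∈ Λ₆, |GQ x y| ≤ c₁ * S₁ :=
    sum_abs_kernel_le hc₁ hδ (fun y _ => hGQ y) (fun y _ => hd₁ y)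
      ((Finset.sum_le_univ_sum_of_nonneg fun _ => (Real.exp_pos _).le).trans hS₁)
  refine bilin_rowdamped_bound (u := u) (d := d₂) (δ := δ / 2) hc₀ (by linarith) (mul_nonneg hqs hG) hF
    (fun y hy y' _ => rowdamped_of_printed hc₀ hδ hd₂ hu0 hCs hC hδC hu_le (h64 hy) y')
    (fun y hy _ => hdeep y hy) (fun y _ y' _ => hd₂ y y')
    (fun y' _ => abs_Qs_restrict_le hG hψ hQs1 y') hS₂0 (fun y _ => ?_)
  rw [show δ / 2 / 2 = δ / 4 by ring]
  exact hS₂ y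

omit [DecidableEq κ] in
/-- **E₂, composite-far**: `|Σ_{y∈Λ₆}Σ_{y′}𝒢(x,y)C(y,y′)(Q*(Λ₄′∖Λ₆′)ψ)(y′)| ≤ c₁c₀e^{−½δ₀R}·qs₁G·S₁S₂` — the block
field `(Λ₄′∖Λ₆′)ψ` is seen only off `Λ₆` (`hQ6`), at distance `≥ R` from `x ∈ Bᵏ(Λ₇)` (`hfar6`, (2.8)), so one of the two
kernels runs at least `½R` (`htri`). [cite: Balaban1982Higgs2, (2.112) p.580] -/
theorem E2_bound {GQ : Matrix ι κ ℝ} {C : Matrix κ κ ℝ} {Qs : Matrix κ ν ℝ} {Λ₆ : Finset κ} {Λ₄' Λ₆' : Finset ν}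
    {ψ : ν → ℝ} {x : ι} {d₁ : ι → κ → ℝ} {d₂ : κ → κ → ℝ} {c₀ c₁ δ R G qs₁ S₁ S₂ : ℝ}
    (hc₀ : 0 ≤ c₀) (hc₁ : 0 ≤ c₁) (hδ : 0 ≤ δ) (hG : 0 ≤ G) (hqs : 0 ≤ qs₁) (hS₂0 : 0 ≤ S₂)
    (hd₁ : ∀ y, 0 ≤ d₁ x y) (hd₂ : ∀ y y', 0 ≤ d₂ y y')
    (hGQ : ∀ y, |GQ x y| ≤ c₁ * Real.exp (-(δ * d₁ x y)))
    (hC : ∀ y y', |C y y'| ≤ c₀ * Real.exp (-(δ * d₂ y y')))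
    (hQ6 : ∀ y z, Qs y z ≠ 0 → (y ∈ Λ₆ ↔ z ∈ Λ₆'))
    (hfar6 : ∀ y, y ∉ Λ₆ → R ≤ d₁ x y) (htri : ∀ y y', d₁ x y' ≤ d₁ x y + d₂ y y')
    (hψ : ∀ z ∈ Λ₄', |ψ z| ≤ G) (hQs1 : ∀ y, ∑ z, |Qs y z| ≤ qs₁)
    (hS₁ : ∑ y, Real.exp (-(δ / 4 * d₁ x y)) ≤ S₁) (hS₂ : ∀ y, ∑ y', Real.exp (-(δ / 4 * d₂ y y')) ≤ S₂) :
    |∑ y ∈ Λ₆, ∑ y', GQ x y * C y y' * (Qs *ᵥ restrict (Λ₄' \ Λ₆') ψ) y'|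
      ≤ c₁ * c₀ * Real.exp (-(δ / 2 * R)) * (qs₁ * G) * S₁ * S₂ := by
  refine comp_far_bound (a := fun y => d₁ x y) (b := d₂) hc₁ hc₀ hδ (mul_nonneg hqs hG) hS₂0
    (fun y _ => hGQ y) (fun y _ y' _ => hC y y') (fun y _ y' _ hg => ?_)
    (fun y' _ => abs_Qs_restrict_le hG (fun z hz => hψ z (Finset.mem_sdiff.1 hz).1) hQs1 y')
    (sum_exp_le_of_rate (by linarith) (fun y _ => hd₁ y)
      ((Finset.sum_le_univ_sum_of_nonneg fun _ => (Real.exp_pos _).le).trans hS₁))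
    (fun y _ => sum_exp_le_of_rate (by linarith) (fun y' _ => hd₂ y y') (hS₂ y))
  obtain ⟨z, hz, hQz⟩ := exists_of_Qs_restrict_ne_zero hg
  have hz6 : z ∉ Λ₆' := (Finset.mem_sdiff.1 hz).2
  have hy'6 : y' ∉ Λ₆ := fun h => hz6 ((hQ6 y' z hQz).1 h)
  exact (hfar6 y' hy'6).trans (htri y y')

/-- **E₃, far in `𝒢`**: `|Σ_{y∉Λ₆}𝒢(x,y)(CQ*Λ₆′ψ)(y)| ≤ c₁e^{−½δ₀R}·(c₀S₂qs₁G)·S₁` — `y ∉ Λ₆` is `≥ R` away from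
`x ∈ Bᵏ(Λ₇)` (`hfar6`, (2.8)). [cite: Balaban1982Higgs2, (2.112) p.580] -/
theorem E3_bound {GQ : Matrix ι κ ℝ} {C : Matrix κ κ ℝ} {Qs : Matrix κ ν ℝ} {Λ₆ : Finset κ} {Λ₄' Λ₆' : Finset ν}
    {ψ : ν → ℝ} {x : ι} {d₁ : ι → κ → ℝ} {d₂ : κ → κ → ℝ} {c₀ c₁ δ R G qs₁ S₁ S₂ : ℝ}
    (hc₀ : 0 ≤ c₀) (hc₁ : 0 ≤ c₁) (hδ : 0 ≤ δ) (hG : 0 ≤ G) (hqs : 0 ≤ qs₁) (hS₂0 : 0 ≤ S₂)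
    (h64' : Λ₆' ⊆ Λ₄') (hd₁ : ∀ y, 0 ≤ d₁ x y) (hd₂ : ∀ y y', 0 ≤ d₂ y y')
    (hGQ : ∀ y, |GQ x y| ≤ c₁ * Real.exp (-(δ * d₁ x y)))
    (hC : ∀ y y', |C y y'| ≤ c₀ * Real.exp (-(δ * d₂ y y')))
    (hfar6 : ∀ y, y ∉ Λ₆ → R ≤ d₁ x y)
    (hψ : ∀ z ∈ Λ₄', |ψ z| ≤ G) (hQs1 : ∀ y, ∑ z, |Qs y z| ≤ qs₁)
    (hS₁ : ∑ y, Real.exp (-(δ / 4 * d₁ x y)) ≤ S₁) (hS₂ : ∀ y, ∑ y', Real.exp (-(δ / 4 * d₂ y y')) ≤ S₂) :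
    |∑ y ∈ Λ₆ᶜ, GQ x y * (C *ᵥ (Qs *ᵥ restrict Λ₆' ψ)) y|
      ≤ c₁ * Real.exp (-(δ / 2 * R)) * (c₀ * S₂ * (qs₁ * G)) * S₁ := by
  refine far_sum_bound (d := fun y => d₁ x y) hc₁ hδ (by positivity) (fun y _ => hGQ y)
    (fun y hy _ => hfar6 y (Finset.mem_compl.1 hy)) (fun y _ => ?_)
    (sum_exp_le_of_rate (by linarith) (fun y _ => hd₁ y)
      ((Finset.sum_le_univ_sum_of_nonneg fun _ => (Real.exp_pos _).le).trans hS₁))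
  calc |(C *ᵥ (Qs *ᵥ restrict Λ₆' ψ)) y| = |∑ y', C y y' * (Qs *ᵥ restrict Λ₆' ψ) y'| := rfl
    _ ≤ ∑ y', |C y y' * (Qs *ᵥ restrict Λ₆' ψ) y'| := Finset.abs_sum_le_sum_abs _ _
    _ ≤ ∑ y', c₀ * Real.exp (-(δ * d₂ y y')) * (qs₁ * G) := Finset.sum_le_sum fun y' _ => by
        rw [abs_mul]
        exact mul_le_mul (hC y y') (abs_Qs_restrict_le hG (fun z hz => hψ z (h64' hz)) hQs1 y')
          (abs_nonneg _) (by positivity)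
    _ = c₀ * (qs₁ * G) * ∑ y', Real.exp (-(δ * d₂ y y')) := by
        rw [Finset.mul_sum]
        exact Finset.sum_congr rfl fun _ _ => by ring
    _ ≤ c₀ * (qs₁ * G) * S₂ := mul_le_mul_of_nonneg_left
        (sum_exp_le_of_rate (by linarith) (fun y' _ => hd₂ y y') (hS₂ y)) (by positivity)
    _ = c₀ * S₂ * (qs₁ * G) := by ring

/-- **(2.112), the error term**: *"we replace C^{(k)}_{Λ₄^{(k)}} by C^{(k)}, Λ₆^{(k)} by 1, and … we get (2.111) = … +
O((Lᵏε)^κ)"* — at a vertex `x ∈ Bᵏ(Λ₇^{(k)})`, with the printed shapes (2.58) for `𝒢 = G_kQ_k^*` (`hGQ`), (I.2.34) for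
`C^{(k)}` (`hC`), (I.2.36) for `δC^{(k)}_{Λ₄} = C^{(k)}_{Λ₄} − C^{(k)}` on `Λ₄ × Λ₄` (`hδC`), the Dirichlet support of
`C^{(k)}_{Λ₄}` (`hCs`), the block structure of `Q*` (`hQ4`, `hQ6`), the (2.8) separations (`hfar6`: `dist(x, Λ₆ᶜ) ≥ R`;
`hdeep`: `dist(Λ₆, Λ₄ᶜ) ≥ R`), the threshold `G` for `|ψ|` on `Λ₄′` ((2.16)) and the summability constants `S₁`, `S₂`:
`|a_kaL⁻²Σ_{y∈Λ₆}𝒢(x,y)(C_{Λ₄}Q*ψ)(y) − a_kaL⁻²Σ_y𝒢(x,y)(CQ*Λ₆′ψ)(y)| ≤ |a_kaL⁻²|·3c₀c₁qs₁S₁S₂·G·e^{−½δ₀R}`.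
[cite: Balaban1982Higgs2, (2.112) p.580] -/
theorem eq2112_error_bound {GQ : Matrix ι κ ℝ} {CΛ C : Matrix κ κ ℝ} {Qs : Matrix κ ν ℝ} {Λ₄ Λ₆ : Finset κ}
    {Λ₄' Λ₆' : Finset ν} {ψ : ν → ℝ} {x : ι} {d₁ : ι → κ → ℝ} {d₂ : κ → κ → ℝ} {u : κ → ℝ}
    {α β c₀ c₁ δ R G qs₁ S₁ S₂ : ℝ}
    (hc₀ : 0 ≤ c₀) (hc₁ : 0 ≤ c₁) (hδ : 0 ≤ δ) (hG : 0 ≤ G) (hqs : 0 ≤ qs₁) (hS₂0 : 0 ≤ S₂)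
    (h64 : Λ₆ ⊆ Λ₄) (h64' : Λ₆' ⊆ Λ₄')
    (hd₁ : ∀ y, 0 ≤ d₁ x y) (hd₂ : ∀ y y', 0 ≤ d₂ y y') (hu0 : ∀ y, 0 ≤ u y)
    (hGQ : ∀ y, |GQ x y| ≤ c₁ * Real.exp (-(δ * d₁ x y)))
    (hCs : ∀ y y', CΛ y y' ≠ 0 → y' ∈ Λ₄)
    (hC : ∀ y y', |C y y'| ≤ c₀ * Real.exp (-(δ * d₂ y y')))
    (hδC : ∀ y ∈ Λ₄, ∀ y' ∈ Λ₄, |CΛ y y' - C y y'| ≤ c₀ * Real.exp (-(δ * (d₂ y y' + u y + u y'))))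
    (hQ4 : ∀ y z, Qs y z ≠ 0 → (y ∈ Λ₄ ↔ z ∈ Λ₄')) (hQ6 : ∀ y z, Qs y z ≠ 0 → (y ∈ Λ₆ ↔ z ∈ Λ₆'))
    (hu_le : ∀ y y', y' ∉ Λ₄ → u y ≤ d₂ y y') (hdeep : ∀ y ∈ Λ₆, R ≤ u y)
    (hfar6 : ∀ y, y ∉ Λ₆ → R ≤ d₁ x y) (htri : ∀ y y', d₁ x y' ≤ d₁ x y + d₂ y y')
    (hψ : ∀ z ∈ Λ₄', |ψ z| ≤ G) (hQs1 : ∀ y, ∑ z, |Qs y z| ≤ qs₁)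
    (hS₁ : ∑ y, Real.exp (-(δ / 4 * d₁ x y)) ≤ S₁) (hS₂ : ∀ y, ∑ y', Real.exp (-(δ / 4 * d₂ y y')) ≤ S₂) :
    |α * β * ∑ y ∈ Λ₆, GQ x y * (CΛ *ᵥ (Qs *ᵥ ψ)) y
        - α * β * ∑ y, GQ x y * (C *ᵥ (Qs *ᵥ restrict Λ₆' ψ)) y|
      ≤ |α * β| * (3 * (c₀ * c₁ * qs₁ * S₁ * S₂) * (Real.exp (-(δ / 2 * R)) * G)) := by
  rw [← mul_sub, abs_mul]
  refine mul_le_mul_of_nonneg_left ?_ (abs_nonneg _)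
  rw [diff_decomp GQ CΛ C Qs hCs hQ4 h64' ψ x]
  set X : ℝ := c₀ * c₁ * qs₁ * S₁ * S₂ * (Real.exp (-(δ / 2 * R)) * G) with hX
  have h1 : |∑ y ∈ Λ₆, ∑ y', GQ x y * (CΛ - C) y y' * (Qs *ᵥ restrict Λ₄' ψ) y'| ≤ X :=
    (E1_bound hc₀ hc₁ hδ hG hqs hS₂0 h64 hd₁ hd₂ hu0 hGQ hCs hC hδC hu_le hdeep hψ hQs1 hS₁ hS₂).trans
      (le_of_eq (by rw [hX]; ring))
  have h2 : |∑ y ∈ Λ₆, ∑ y', GQ x y * C y y' * (Qs *ᵥ restrict (Λ₄' \ Λ₆') ψ) y'| ≤ X :=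
    (E2_bound hc₀ hc₁ hδ hG hqs hS₂0 hd₁ hd₂ hGQ hC hQ6 hfar6 htri hψ hQs1 hS₁ hS₂).trans
      (le_of_eq (by rw [hX]; ring))
  have h3 : |∑ y ∈ Λ₆ᶜ, GQ x y * (C *ᵥ (Qs *ᵥ restrict Λ₆' ψ)) y| ≤ X :=
    (E3_bound hc₀ hc₁ hδ hG hqs hS₂0 h64' hd₁ hd₂ hGQ hC hfar6 hψ hQs1 hS₁ hS₂).trans
      (le_of_eq (by rw [hX]; ring))
  obtain ⟨h1a, h1b⟩ := abs_le.1 h1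
  obtain ⟨h2a, h2b⟩ := abs_le.1 h2
  obtain ⟨h3a, h3b⟩ := abs_le.1 h3
  have hfin : 3 * (c₀ * c₁ * qs₁ * S₁ * S₂) * (Real.exp (-(δ / 2 * R)) * G) = 3 * X := by rw [hX]; ring
  rw [hfin, abs_le]
  constructor <;> linarith

/-- **(2.112), "O((Lᵏε)^κ)"**: with the separation `R ≥ r(ℓ)` (`ℓ = Lᵏε`, (2.8)) and `e^{−½δ₀r(ℓ)}·G ≤ C_κℓ^κ`
(`B2Eq225PsiOne.decay_threshold_pow₁` / `decay_thr216_pow` for the printed threshold), the error of (2.112) is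
`≤ |a_kaL⁻²|·3c₀c₁qs₁S₁S₂·C_κ·ℓ^κ`. [cite: Balaban1982Higgs2, (2.112) p.580] -/
theorem eq2112_error_pow {GQ : Matrix ι κ ℝ} {CΛ C : Matrix κ κ ℝ} {Qs : Matrix κ ν ℝ} {Λ₄ Λ₆ : Finset κ}
    {Λ₄' Λ₆' : Finset ν} {ψ : ν → ℝ} {x : ι} {d₁ : ι → κ → ℝ} {d₂ : κ → κ → ℝ} {u : κ → ℝ}
    {α β c₀ c₁ δ R G qs₁ S₁ S₂ Rr r ℓ κ' Cκ : ℝ}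
    (hc₀ : 0 ≤ c₀) (hc₁ : 0 ≤ c₁) (hδ : 0 ≤ δ) (hG : 0 ≤ G) (hqs : 0 ≤ qs₁) (hS₁0 : 0 ≤ S₁) (hS₂0 : 0 ≤ S₂)
    (h64 : Λ₆ ⊆ Λ₄) (h64' : Λ₆' ⊆ Λ₄')
    (hd₁ : ∀ y, 0 ≤ d₁ x y) (hd₂ : ∀ y y', 0 ≤ d₂ y y') (hu0 : ∀ y, 0 ≤ u y)
    (hGQ : ∀ y, |GQ x y| ≤ c₁ * Real.exp (-(δ * d₁ x y)))
    (hCs : ∀ y y', CΛ y y' ≠ 0 → y' ∈ Λ₄)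
    (hC : ∀ y y', |C y y'| ≤ c₀ * Real.exp (-(δ * d₂ y y')))
    (hδC : ∀ y ∈ Λ₄, ∀ y' ∈ Λ₄, |CΛ y y' - C y y'| ≤ c₀ * Real.exp (-(δ * (d₂ y y' + u y + u y'))))
    (hQ4 : ∀ y z, Qs y z ≠ 0 → (y ∈ Λ₄ ↔ z ∈ Λ₄')) (hQ6 : ∀ y z, Qs y z ≠ 0 → (y ∈ Λ₆ ↔ z ∈ Λ₆'))
    (hu_le : ∀ y y', y' ∉ Λ₄ → u y ≤ d₂ y y') (hdeep : ∀ y ∈ Λ₆, R ≤ u y)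
    (hfar6 : ∀ y, y ∉ Λ₆ → R ≤ d₁ x y) (htri : ∀ y y', d₁ x y' ≤ d₁ x y + d₂ y y')
    (hψ : ∀ z ∈ Λ₄', |ψ z| ≤ G) (hQs1 : ∀ y, ∑ z, |Qs y z| ≤ qs₁)
    (hS₁ : ∑ y, Real.exp (-(δ / 4 * d₁ x y)) ≤ S₁) (hS₂ : ∀ y, ∑ y', Real.exp (-(δ / 4 * d₂ y y')) ≤ S₂)
    (hRr : B2.rFn Rr r ℓ ≤ R) (hCκ : Real.exp (-(δ / 2 * B2.rFn Rr r ℓ)) * G ≤ Cκ * ℓ ^ κ') :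
    |α * β * ∑ y ∈ Λ₆, GQ x y * (CΛ *ᵥ (Qs *ᵥ ψ)) y
        - α * β * ∑ y, GQ x y * (C *ᵥ (Qs *ᵥ restrict Λ₆' ψ)) y|
      ≤ |α * β| * (3 * (c₀ * c₁ * qs₁ * S₁ * S₂)) * (Cκ * ℓ ^ κ') := by
  have h := eq2112_error_bound (α := α) (β := β) hc₀ hc₁ hδ hG hqs hS₂0 h64 h64' hd₁ hd₂ hu0 hGQ hCs hC hδC
    hQ4 hQ6 hu_le hdeep hfar6 htri hψ hQs1 hS₁ hS₂
  have hexp : Real.exp (-(δ / 2 * R)) ≤ Real.exp (-(δ / 2 * B2.rFn Rr r ℓ)) := by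
    rw [Real.exp_le_exp]
    nlinarith
  have h2 : Real.exp (-(δ / 2 * R)) * G ≤ Cκ * ℓ ^ κ' := (mul_le_mul_of_nonneg_right hexp hG).trans hCκ
  have hX0 : 0 ≤ |α * β| * (3 * (c₀ * c₁ * qs₁ * S₁ * S₂)) := by positivity
  calc |α * β * ∑ y ∈ Λ₆, GQ x y * (CΛ *ᵥ (Qs *ᵥ ψ)) y
          - α * β * ∑ y, GQ x y * (C *ᵥ (Qs *ᵥ restrict Λ₆' ψ)) y|
      ≤ |α * β| * (3 * (c₀ * c₁ * qs₁ * S₁ * S₂) * (Real.exp (-(δ / 2 * R)) * G)) := h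
    _ = |α * β| * (3 * (c₀ * c₁ * qs₁ * S₁ * S₂)) * (Real.exp (-(δ / 2 * R)) * G) := by ring
    _ ≤ |α * β| * (3 * (c₀ * c₁ * qs₁ * S₁ * S₂)) * (Cκ * ℓ ^ κ') := mul_le_mul_of_nonneg_left h2 hX0

/-- **The vertex-variable replacement of the sentence before (2.111)** p. 580: *"If x in (aL⁻²C^{(k)}_{Λ₄^{(k)}}(…)Q*(…)ψ)(x)
is a vertex variable, then x ∈ Λ₇^{(k)}, and we replace this configuration by (aL⁻²C^{(k)}(…)Q*(…)Λ₆^{(k)′}ψ)(x)"* — at a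
unit-lattice vertex `y` lying `≥ R` inside `Λ₄` (`hdeep`) and `≥ R` away from `Λ₆ᶜ` (`hfar`; both (2.8) for `y ∈ Λ₇^{(k)}`),
the cost is `|aL⁻²(C_{Λ₄}Q*ψ)(y) − aL⁻²(CQ*Λ₆′ψ)(y)| ≤ |aL⁻²|·2c₀qs₁S₂·G·e^{−½δ₀R}` (row-damped + far).
[cite: Balaban1982Higgs2, (2.111) p.580] -/
theorem vertex_replacement_bound {CΛ C : Matrix κ κ ℝ} {Qs : Matrix κ ν ℝ} {Λ₄ Λ₆ : Finset κ} {Λ₄' Λ₆' : Finset ν}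
    {ψ : ν → ℝ} {y : κ} {d₂ : κ → κ → ℝ} {u : κ → ℝ} {β c₀ δ R G qs₁ S₂ : ℝ}
    (hc₀ : 0 ≤ c₀) (hδ : 0 ≤ δ) (hG : 0 ≤ G) (hqs : 0 ≤ qs₁) (h64' : Λ₆' ⊆ Λ₄') (hy4 : y ∈ Λ₄)
    (hd₂ : ∀ y y', 0 ≤ d₂ y y') (hu0 : ∀ y, 0 ≤ u y)
    (hCs : ∀ y y', CΛ y y' ≠ 0 → y' ∈ Λ₄)
    (hC : ∀ y y', |C y y'| ≤ c₀ * Real.exp (-(δ * d₂ y y')))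
    (hδC : ∀ y ∈ Λ₄, ∀ y' ∈ Λ₄, |CΛ y y' - C y y'| ≤ c₀ * Real.exp (-(δ * (d₂ y y' + u y + u y'))))
    (hQ4 : ∀ y z, Qs y z ≠ 0 → (y ∈ Λ₄ ↔ z ∈ Λ₄')) (hQ6 : ∀ y z, Qs y z ≠ 0 → (y ∈ Λ₆ ↔ z ∈ Λ₆'))
    (hu_le : ∀ y y', y' ∉ Λ₄ → u y ≤ d₂ y y') (hdeep : R ≤ u y) (hfar : ∀ y', y' ∉ Λ₆ → R ≤ d₂ y y')
    (hψ : ∀ z ∈ Λ₄', |ψ z| ≤ G) (hQs1 : ∀ y, ∑ z, |Qs y z| ≤ qs₁)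
    (hS₂ : ∑ y', Real.exp (-(δ / 4 * d₂ y y')) ≤ S₂) :
    |β * (CΛ *ᵥ (Qs *ᵥ ψ)) y - β * (C *ᵥ (Qs *ᵥ restrict Λ₆' ψ)) y|
      ≤ |β| * (2 * (c₀ * qs₁ * S₂) * (Real.exp (-(δ / 2 * R)) * G)) := by
  rw [← mul_sub, abs_mul]
  refine mul_le_mul_of_nonneg_left ?_ (abs_nonneg _)
  have hdec : (CΛ *ᵥ (Qs *ᵥ ψ)) y - (C *ᵥ (Qs *ᵥ restrict Λ₆' ψ)) y
      = ∑ y', (CΛ - C) y y' * (Qs *ᵥ restrict Λ₄' ψ) y'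
        + ∑ y', C y y' * (Qs *ᵥ restrict (Λ₄' \ Λ₆') ψ) y' := by
    rw [mulVec_CΛ_eq_restrict hCs hQ4 ψ y, ← restrict_sub_restrict h64' ψ, Matrix.mulVec_sub]
    have e1 : (CΛ *ᵥ (Qs *ᵥ restrict Λ₄' ψ)) y = ∑ y', CΛ y y' * (Qs *ᵥ restrict Λ₄' ψ) y' := rfl
    have e2 : (C *ᵥ (Qs *ᵥ restrict Λ₆' ψ)) y = ∑ y', C y y' * (Qs *ᵥ restrict Λ₆' ψ) y' := rfl
    rw [e1, e2, ← Finset.sum_sub_distrib, ← Finset.sum_add_distrib]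
    refine Finset.sum_congr rfl fun y' _ => ?_
    rw [Matrix.sub_apply, Pi.sub_apply]
    ring
  rw [hdec]
  set X : ℝ := c₀ * qs₁ * S₂ * (Real.exp (-(δ / 2 * R)) * G) with hX
  have h1 : |∑ y', (CΛ - C) y y' * (Qs *ᵥ restrict Λ₄' ψ) y'| ≤ X := by
    have hD : ∀ y' ∈ (Finset.univ : Finset κ), |(CΛ - C) y y'|
        ≤ c₀ * Real.exp (-(δ / 2 * (d₂ y y' + u y + (fun _ => (0 : ℝ)) y'))) := fun y' _ => by
      simpa only [add_zero] using rowdamped_of_printed hc₀ hδ hd₂ hu0 hCs hC hδC hu_le hy4 y'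
    have h := B2Lemma25Proof.damped_sum_bound (u' := fun _ => (0 : ℝ)) (d := d₂ y) (c₀ := c₀) (δ := δ / 2)
      (R := R) (G := qs₁ * G) (u := u y) (Ssum := S₂) hc₀ (by linarith)
      (mul_nonneg hqs hG) hdeep (fun _ _ => le_rfl) (fun y' _ => hd₂ y y') hD
      (fun y' _ => abs_Qs_restrict_le hG hψ hQs1 y') (by rw [show δ / 2 / 2 = δ / 4 by ring]; exact hS₂)
    exact h.trans (le_of_eq (by rw [hX]; ring))
  have h2 : |∑ y', C y y' * (Qs *ᵥ restrict (Λ₄' \ Λ₆') ψ) y'| ≤ X := by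
    have hfar' : ∀ y' ∈ (Finset.univ : Finset κ), (Qs *ᵥ restrict (Λ₄' \ Λ₆') ψ) y' ≠ 0 → R ≤ d₂ y y' := by
      intro y' _ hg
      obtain ⟨z, hz, hQz⟩ := exists_of_Qs_restrict_ne_zero hg
      have hz6 : z ∉ Λ₆' := (Finset.mem_sdiff.1 hz).2
      exact hfar y' fun h => hz6 ((hQ6 y' z hQz).1 h)
    have h := far_sum_bound (d := d₂ y) (c₀ := c₀) (δ := δ) (R := R) (G := qs₁ * G) (Ssum := S₂) hc₀ hδ
      (mul_nonneg hqs hG) (fun y' _ => hC y y') hfar'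
      (fun y' _ => abs_Qs_restrict_le hG (fun z hz => hψ z (Finset.mem_sdiff.1 hz).1) hQs1 y')
      (sum_exp_le_of_rate (by linarith) (fun y' _ => hd₂ y y') hS₂)
    exact h.trans (le_of_eq (by rw [hX]; ring))
  obtain ⟨h1a, h1b⟩ := abs_le.1 h1
  obtain ⟨h2a, h2b⟩ := abs_le.1 h2
  have hfin : 2 * (c₀ * qs₁ * S₂) * (Real.exp (-(δ / 2 * R)) * G) = 2 * X := by rw [hX]; ring
  rw [hfin, abs_le]
  constructor <;> linarith

end Main

/-! ## §3 KNIT over `B1RG242.StepData`: r14's `eq2112_of_replacement` with `hrepl` discharged -/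

section Knit

variable {ι κ ν : Type*} [Fintype ι] [Fintype κ] [Fintype ν] [DecidableEq ι] [DecidableEq κ] [DecidableEq ν]
variable (S : B1RG242.StepData ℝ ι κ ν)

omit [DecidableEq ν] in
/-- **(2.111) in the operator currency of `B2IndStep2115`**: the configuration
`(a_kG_kQ_k^*·Λ₆^{(k)}·aL⁻²C^{(k)}_{Λ₄^{(k)}}Q*ψ)(x)` as a matrix expression over part I's `B1RG242.StepData` (`S.Gk * S.Qks` ↤
`G_kQ_k^*`, `S.α` ↤ `a_k`, `S.β` ↤ `aL⁻²`, `S.Qs` ↤ `Q*`, the cut-off `Λ₆^{(k)}` as the 0/1 diagonal, `CΛ` ↤ `C^{(k)}_{Λ₄}`)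
equals the explicit kernel sum of §2. KERNEL. [cite: Balaban1982Higgs2, (2.111) p.580] -/
theorem lhs2111_eq (Λ₆ : Finset κ) (CΛ : Matrix κ κ ℝ) (ψ : ν → ℝ) (x : ι) :
    (((S.α * S.β) • (S.Gk * S.Qks * Matrix.diagonal (fun y => if y ∈ Λ₆ then (1 : ℝ) else 0) * CΛ * S.Qs))
        *ᵥ ψ) x
      = S.α * S.β * ∑ y ∈ Λ₆, (S.Gk * S.Qks) x y * (CΛ *ᵥ (S.Qs *ᵥ ψ)) y := by
  rw [Matrix.smul_mulVec, Pi.smul_apply, smul_eq_mul]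
  congr 1
  rw [← Matrix.mulVec_mulVec, ← Matrix.mulVec_mulVec, ← Matrix.mulVec_mulVec]
  change ∑ y, (S.Gk * S.Qks) x y
      * (Matrix.diagonal (fun y => if y ∈ Λ₆ then (1 : ℝ) else 0) *ᵥ (CΛ *ᵥ (S.Qs *ᵥ ψ))) y = _
  have h : ∀ y, (S.Gk * S.Qks) x y
      * (Matrix.diagonal (fun y => if y ∈ Λ₆ then (1 : ℝ) else 0) *ᵥ (CΛ *ᵥ (S.Qs *ᵥ ψ))) y
      = if y ∈ Λ₆ then (S.Gk * S.Qks) x y * (CΛ *ᵥ (S.Qs *ᵥ ψ)) y else 0 := by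
    intro y
    rw [Matrix.mulVec_diagonal]
    split_ifs <;> simp
  rw [Finset.sum_congr rfl fun y _ => h y, Finset.sum_ite_mem, Finset.univ_inter]

omit [DecidableEq ν] in
/-- **The right side of (2.112) before (I.2.41)**: `(a_kaL⁻²·G_kQ_k^*C^{(k)}Q*v)(x)` over `B1RG242.StepData` equals the
explicit kernel sum of §2 (`v` ↤ `Λ₆^{(k)′}ψ`). KERNEL. [cite: Balaban1982Higgs2, (2.112) p.580] -/
theorem rhs2112_eq (v : ν → ℝ) (x : ι) :
    (((S.α * S.β) • (S.Gk * S.Qks * S.Ck * S.Qs)) *ᵥ v) x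
      = S.α * S.β * ∑ y, (S.Gk * S.Qks) x y * (S.Ck *ᵥ (S.Qs *ᵥ v)) y := by
  rw [Matrix.smul_mulVec, Pi.smul_apply, smul_eq_mul]
  congr 1
  rw [← Matrix.mulVec_mulVec, ← Matrix.mulVec_mulVec]
  rfl

/-- **(2.112) WITH ITS PRINTED ERROR, KNIT**: r14's `B2IndStep2115.eq2112_of_replacement` (the exact part = part I (2.41)
via `B1Eq333Decomposition.eq342_op`) with its replacement hypothesis `hrepl` DISCHARGED by `eq2112_error_bound`:
at a vertex `x ∈ Bᵏ(Λ₇^{(k)})`, under the printed shapes (2.58) for `G_kQ_k^* = S.Gk * S.Qks`, (I.2.34)/(I.2.36) for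
`C^{(k)} = S.Ck` and `C^{(k)}_{Λ₄}`, the block structure of `Q* = S.Qs`, the (2.8) separations and the (2.16) threshold,
`|(a_kG_kQ_k^*Λ₆aL⁻²C^{(k)}_{Λ₄}Q*ψ)(x) − (a_{k+1}L⁻²G_{k+1}Q*_{k+1}Λ₆′ψ)(x)| ≤ |a_kaL⁻²|·3c₀c₁qs₁S₁S₂·G·e^{−½δ₀R}`
(`S.γ` ↤ `a_{k+1}L⁻²` by (I.2.13), `S.Gk1`, `S.Qk1s` ↤ `G_{k+1}`, `Q*_{k+1}`). [cite: Balaban1982Higgs2, (2.112) p.580] -/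
theorem eq2112_replacement (hQ : S.Q * S.Qs = 1) (hαβ : S.α + S.β ≠ 0) (hG : IsUnit (S.H + S.α • S.Pk))
    (hCk : IsUnit (S.β • S.P + S.Δk)) {CΛ : Matrix κ κ ℝ} {Λ₄ Λ₆ : Finset κ} {Λ₄' Λ₆' : Finset ν} {ψ : ν → ℝ}
    {x : ι} {d₁ : ι → κ → ℝ} {d₂ : κ → κ → ℝ} {u : κ → ℝ} {c₀ c₁ δ R G qs₁ S₁ S₂ : ℝ}
    (hc₀ : 0 ≤ c₀) (hc₁ : 0 ≤ c₁) (hδ : 0 ≤ δ) (hG0 : 0 ≤ G) (hqs : 0 ≤ qs₁) (hS₂0 : 0 ≤ S₂)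
    (h64 : Λ₆ ⊆ Λ₄) (h64' : Λ₆' ⊆ Λ₄')
    (hd₁ : ∀ y, 0 ≤ d₁ x y) (hd₂ : ∀ y y', 0 ≤ d₂ y y') (hu0 : ∀ y, 0 ≤ u y)
    (hGQ : ∀ y, |(S.Gk * S.Qks) x y| ≤ c₁ * Real.exp (-(δ * d₁ x y)))
    (hCs : ∀ y y', CΛ y y' ≠ 0 → y' ∈ Λ₄)
    (hC : ∀ y y', |S.Ck y y'| ≤ c₀ * Real.exp (-(δ * d₂ y y')))
    (hδC : ∀ y ∈ Λ₄, ∀ y' ∈ Λ₄, |CΛ y y' - S.Ck y y'| ≤ c₀ * Real.exp (-(δ * (d₂ y y' + u y + u y'))))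
    (hQ4 : ∀ y z, S.Qs y z ≠ 0 → (y ∈ Λ₄ ↔ z ∈ Λ₄')) (hQ6 : ∀ y z, S.Qs y z ≠ 0 → (y ∈ Λ₆ ↔ z ∈ Λ₆'))
    (hu_le : ∀ y y', y' ∉ Λ₄ → u y ≤ d₂ y y') (hdeep : ∀ y ∈ Λ₆, R ≤ u y)
    (hfar6 : ∀ y, y ∉ Λ₆ → R ≤ d₁ x y) (htri : ∀ y y', d₁ x y' ≤ d₁ x y + d₂ y y')
    (hψ : ∀ z ∈ Λ₄', |ψ z| ≤ G) (hQs1 : ∀ y, ∑ z, |S.Qs y z| ≤ qs₁)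
    (hS₁ : ∑ y, Real.exp (-(δ / 4 * d₁ x y)) ≤ S₁) (hS₂ : ∀ y, ∑ y', Real.exp (-(δ / 4 * d₂ y y')) ≤ S₂) :
    |(((S.α * S.β) • (S.Gk * S.Qks * Matrix.diagonal (fun y => if y ∈ Λ₆ then (1 : ℝ) else 0) * CΛ * S.Qs))
          *ᵥ ψ) x
        - ((S.γ • (S.Gk1 * S.Qk1s)) *ᵥ restrict Λ₆' ψ) x|
      ≤ |S.α * S.β| * (3 * (c₀ * c₁ * qs₁ * S₁ * S₂) * (Real.exp (-(δ / 2 * R)) * G)) := by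
  refine B2IndStep2115.eq2112_of_replacement S hQ hαβ hG hCk (restrict Λ₆' ψ) x ?_
  rw [lhs2111_eq, rhs2112_eq]
  exact eq2112_error_bound hc₀ hc₁ hδ hG0 hqs hS₂0 h64 h64' hd₁ hd₂ hu0 hGQ hCs hC hδC hQ4 hQ6 hu_le hdeep
    hfar6 htri hψ hQs1 hS₁ hS₂

/-- **(2.112) as printed, "O((Lᵏε)^κ)", KNIT**: with `R ≥ r(ℓ)` and `e^{−½δ₀r(ℓ)}·G ≤ C_κℓ^κ`,
`|(2.111)(x) − (a_{k+1}L⁻²G_{k+1}Q*_{k+1}Λ₆^{(k)′}ψ)(x)| ≤ |a_kaL⁻²|·3c₀c₁qs₁S₁S₂·C_κ·ℓ^κ`.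
[cite: Balaban1982Higgs2, (2.112) p.580] -/
theorem eq2112_replacement_pow (hQ : S.Q * S.Qs = 1) (hαβ : S.α + S.β ≠ 0) (hG : IsUnit (S.H + S.α • S.Pk))
    (hCk : IsUnit (S.β • S.P + S.Δk)) {CΛ : Matrix κ κ ℝ} {Λ₄ Λ₆ : Finset κ} {Λ₄' Λ₆' : Finset ν} {ψ : ν → ℝ}
    {x : ι} {d₁ : ι → κ → ℝ} {d₂ : κ → κ → ℝ} {u : κ → ℝ} {c₀ c₁ δ R G qs₁ S₁ S₂ Rr r ℓ κ' Cκ : ℝ}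
    (hc₀ : 0 ≤ c₀) (hc₁ : 0 ≤ c₁) (hδ : 0 ≤ δ) (hG0 : 0 ≤ G) (hqs : 0 ≤ qs₁) (hS₁0 : 0 ≤ S₁) (hS₂0 : 0 ≤ S₂)
    (h64 : Λ₆ ⊆ Λ₄) (h64' : Λ₆' ⊆ Λ₄')
    (hd₁ : ∀ y, 0 ≤ d₁ x y) (hd₂ : ∀ y y', 0 ≤ d₂ y y') (hu0 : ∀ y, 0 ≤ u y)
    (hGQ : ∀ y, |(S.Gk * S.Qks) x y| ≤ c₁ * Real.exp (-(δ * d₁ x y)))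
    (hCs : ∀ y y', CΛ y y' ≠ 0 → y' ∈ Λ₄)
    (hC : ∀ y y', |S.Ck y y'| ≤ c₀ * Real.exp (-(δ * d₂ y y')))
    (hδC : ∀ y ∈ Λ₄, ∀ y' ∈ Λ₄, |CΛ y y' - S.Ck y y'| ≤ c₀ * Real.exp (-(δ * (d₂ y y' + u y + u y'))))
    (hQ4 : ∀ y z, S.Qs y z ≠ 0 → (y ∈ Λ₄ ↔ z ∈ Λ₄')) (hQ6 : ∀ y z, S.Qs y z ≠ 0 → (y ∈ Λ₆ ↔ z ∈ Λ₆'))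
    (hu_le : ∀ y y', y' ∉ Λ₄ → u y ≤ d₂ y y') (hdeep : ∀ y ∈ Λ₆, R ≤ u y)
    (hfar6 : ∀ y, y ∉ Λ₆ → R ≤ d₁ x y) (htri : ∀ y y', d₁ x y' ≤ d₁ x y + d₂ y y')
    (hψ : ∀ z ∈ Λ₄', |ψ z| ≤ G) (hQs1 : ∀ y, ∑ z, |S.Qs y z| ≤ qs₁)
    (hS₁ : ∑ y, Real.exp (-(δ / 4 * d₁ x y)) ≤ S₁) (hS₂ : ∀ y, ∑ y', Real.exp (-(δ / 4 * d₂ y y')) ≤ S₂)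
    (hRr : B2.rFn Rr r ℓ ≤ R) (hCκ : Real.exp (-(δ / 2 * B2.rFn Rr r ℓ)) * G ≤ Cκ * ℓ ^ κ') :
    |(((S.α * S.β) • (S.Gk * S.Qks * Matrix.diagonal (fun y => if y ∈ Λ₆ then (1 : ℝ) else 0) * CΛ * S.Qs))
          *ᵥ ψ) x
        - ((S.γ • (S.Gk1 * S.Qk1s)) *ᵥ restrict Λ₆' ψ) x|
      ≤ |S.α * S.β| * (3 * (c₀ * c₁ * qs₁ * S₁ * S₂)) * (Cκ * ℓ ^ κ') := by
  refine B2IndStep2115.eq2112_of_replacement S hQ hαβ hG hCk (restrict Λ₆' ψ) x ?_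
  rw [lhs2111_eq, rhs2112_eq]
  exact eq2112_error_pow hc₀ hc₁ hδ hG0 hqs hS₁0 hS₂0 h64 h64' hd₁ hd₂ hu0 hGQ hCs hC hδC hQ4 hQ6 hu_le
    hdeep hfar6 htri hψ hQs1 hS₁ hS₂ hRr hCκ

end Knit
end Literature.MathematicalPhysics.QuantumFieldTheory.Balaban1983to89.B2Eq2112Replacement
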